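import Summits.QuantumFields.BalabanUV.Beta.EriceFlowEnclosureBorelSeries
import Summits.QuantumFields.BalabanUV.Beta.EriceFlowEnclosureBorelTransformDeriv

/-!
# Beta / EriceFlowEnclosureBorelTransformPieces — THE BOREL TRANSFORM ON THE LINE SPLITS AS LETTERS + REMAINDER: for `G` holomorphic
# on `Re w > c₀ > 0` with the uniform Gevrey-1 remainders `‖G w − Σ_{1≤n<N} a_n∕w^{n+1}‖ ≤ C·K^N·N!∕‖w‖^{N+1}` (the shape 34f extracts
# from a function on the Borel DISC as well as from one on a wide sector), the Bromwich integral `J[G](t) = ∫_ℝ e^{t(c+is)}G(c+is)ds =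
# e^{ct}·𝓕[G(c − i·)](t∕2π)` equals, for `t ≥ 0` and every `N ≥ 1`, `2π·Σ_{1≤n<N} a_n tⁿ∕n! + J[R_N](t)` with `R_N = O(C K^N N!∕‖w‖^{N+1})`
# on the line — the decomposition from which the derivatives of the Borel transform are read (36c)
# (bflow-p3 gen 39, exploratory MODULE 36b over 34c ∕ 34d ∕ 34e ∕ 36a; Mathlib + tree only)

HONEST FRAMING (page 1 of everything the β sub-cell writes): discharging `BetaPertH` makes Bałaban's UV stability UNCONDITIONAL — a
real constructive-QFT result; it is NOT the continuum limit and NOT the Clay problem.  HONEST DEPENDENCY (cell reorg 2026-08-19,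
verbatim): «continuum YM on T⁴ ⇐ BetaPertH ∧ nine spine estimates (0/9 proved); BetaPertH ⇐ (D1) ∧ (D4) ∧ CAP+tail; G-an2-4 gates
asym, D1 and NE2/3/4.»  THIS MODULE DISCHARGES NOTHING: [folklore] bookkeeping over 34c–34e (no β-function, no flow, no Erice
sentence is used).

SOURCE (shapes only).  [Rivasseau1991] Thm I.5.1 pp. 55–56 (Nevanlinna–Sokal, disc∕strip form: |R_r(y)| ≤ Cσ^r r!|y|^r uniformly in
C_R — our condensation); [LodayRichaud2016] Thm 5.3.9 pp. 156–163.

WHAT THIS FILE PROVES (0 sorry, 0 def).  §1 set-agnostic letters and remainders: `norm_letter_le_of_mem` (`‖a_N‖ ≤ CK^N N!` as soon as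
the small positive reals lie in the domain), `remainder_G_of_mem` (the inverted remainders at every `w ≠ 0` with `w⁻¹` in the domain),
and the Borel DISC instances `ofReal_mem_borelDisc`, `inv_mem_borelDisc`.  §2 the line forms: `line_eq_bline` (`J[G](t) =
e^{ct}𝓕[G(c−i·)](t∕2π)`), `norm_line_le` (`‖J[H](t)‖ ≤ e^{ct}·D·π∕c`, no continuity needed), `line_monomial` (`J[1∕w^{n+1}](t) = 2π·tⁿ∕n!`, `t ≥ 0`).
§3 the remainder on the line: `remainder_line_bound` (`‖(c+is)^j R_N(c+is)‖ ≤ (CK^N N!∕c^{N−1−j})∕(c²+s²)`, `j ≤ N − 1`),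
`continuous_remainder_line`.  §4 **`line_decomposition`**: `J[G](t) = 2π·Σ_{1≤n<N} a_n tⁿ∕n! + J[R_N](t)` for `t ≥ 0`.
-/

namespace Summit.QuantumFields.BalabanUV.Beta.EriceFlowEnclosureBorelTransformPieces

open Set Filter Topology MeasureTheory Metric Complex
open scoped Real Nat FourierTransform
open Summit.QuantumFields.BalabanUV.Beta.EriceFlowEnclosureBorelTransform
open Summit.QuantumFields.BalabanUV.Beta.EriceFlowEnclosureBorelMonomial (bline_monomial differentiableOn_monomial norm_monomial_le)
open Summit.QuantumFields.BalabanUV.Beta.EriceFlowEnclosureBorelSeries (integrable_slice_of_bound line_decay_le)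
open Summit.QuantumFields.BalabanUV.Beta.EriceFlowEnclosureBorelContour (norm_sq_line)
open Summit.QuantumFields.BalabanUV.Beta.EriceFlowEnclosureBorelTransformDeriv

noncomputable section

/-! ## §1 Letters and inverted remainders from a uniform Gevrey-1 bound on ANY domain reaching `0⁺` -/

/-- **Size of the letters** from a uniform Gevrey-1 bound on a domain `U` containing the small positive reals (orders `N` and
`N+1` at `x → 0⁺`). [folklore] -/
theorem norm_letter_le_of_mem {f : ℂ → ℂ} {a : ℕ → ℂ} {U : Set ℂ} {r C K : ℝ} (hr : 0 < r)
    (hU : ∀ x : ℝ, 0 < x → x < r → ((x : ℂ)) ∈ U)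
    (hgev : ∀ N : ℕ, ∀ z ∈ U, ‖f z - ∑ n ∈ Finset.range N, a n * z ^ n‖ ≤ C * K ^ N * N ! * ‖z‖ ^ N) (N : ℕ) :
    ‖a N‖ ≤ C * K ^ N * N ! := by
  have hkey : ∀ x : ℝ, 0 < x → x < r → ‖a N‖ ≤ C * K ^ N * N ! + C * K ^ (N + 1) * (N + 1)! * x := by
    intro x hx hxr
    have hmem := hU x hx hxr
    have h1 := hgev N (x : ℂ) hmem
    have h2 := hgev (N + 1) (x : ℂ) hmem
    have hnx : ‖(x : ℂ)‖ = x := by rw [Complex.norm_real, Real.norm_of_nonneg hx.le]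
    rw [hnx] at h1 h2
    rw [Finset.sum_range_succ] at h2
    have hdiff : a N * (x : ℂ) ^ N = (f x - ∑ n ∈ Finset.range N, a n * (x : ℂ) ^ n) -
        (f x - (∑ n ∈ Finset.range N, a n * (x : ℂ) ^ n + a N * (x : ℂ) ^ N)) := by ring
    have h3 : ‖a N‖ * x ^ N ≤ C * K ^ N * N ! * x ^ N + C * K ^ (N + 1) * (N + 1)! * x ^ (N + 1) := by
      calc ‖a N‖ * x ^ N = ‖a N * (x : ℂ) ^ N‖ := by rw [norm_mul, Complex.norm_pow, hnx]
        _ ≤ _ := by rw [hdiff]; exact (norm_sub_le _ _).trans (add_le_add h1 (by exact_mod_cast h2))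
    have hxN : 0 < x ^ N := pow_pos hx N
    have : ‖a N‖ * x ^ N ≤ (C * K ^ N * N ! + C * K ^ (N + 1) * (N + 1)! * x) * x ^ N := by
      calc ‖a N‖ * x ^ N ≤ C * K ^ N * N ! * x ^ N + C * K ^ (N + 1) * (N + 1)! * x ^ (N + 1) := h3
        _ = (C * K ^ N * N ! + C * K ^ (N + 1) * (N + 1)! * x) * x ^ N := by ring
    exact le_of_mul_le_mul_right this hxN
  have hlim : Tendsto (fun x : ℝ => C * K ^ N * N ! + C * K ^ (N + 1) * (N + 1)! * x) (𝓝[>] 0)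
      (𝓝 (C * K ^ N * N ! + C * K ^ (N + 1) * (N + 1)! * 0)) :=
    ((tendsto_id.const_mul _).const_add _).mono_left nhdsWithin_le_nhds
  rw [mul_zero, add_zero] at hlim
  refine ge_of_tendsto hlim ?_
  have hev : ∀ᶠ x : ℝ in 𝓝[>] 0, x < r := mem_nhdsWithin_of_mem_nhds (Iio_mem_nhds hr)
  filter_upwards [hev, self_mem_nhdsWithin] with x hxr hx
  exact hkey x hx hxr

/-- **Inverted remainders**: from the uniform Gevrey-1 bound on `U`, at every `w ≠ 0` with `w⁻¹ ∈ U` and for `N ≥ 1`: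
`‖(f(w⁻¹) − a₀)∕w − Σ_{1≤n<N} a_n∕w^{n+1}‖ ≤ C·K^N·N!∕‖w‖^{N+1}`. [folklore] -/
theorem remainder_G_of_mem {f : ℂ → ℂ} {a : ℕ → ℂ} {U : Set ℂ} {C K : ℝ}
    (hgev : ∀ N : ℕ, ∀ z ∈ U, ‖f z - ∑ n ∈ Finset.range N, a n * z ^ n‖ ≤ C * K ^ N * N ! * ‖z‖ ^ N)
    {N : ℕ} (hN : 1 ≤ N) (w : ℂ) (hw0 : w ≠ 0) (hwU : w⁻¹ ∈ U) :
    ‖(fun w : ℂ => (f w⁻¹ - a 0) / w) w - ∑ n ∈ Finset.Ico 1 N, a n * (1 / w ^ (n + 1))‖ ≤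
      C * K ^ N * N ! / ‖w‖ ^ (N + 1) := by
  have hwpos : 0 < ‖w‖ := norm_pos_iff.mpr hw0
  have h := hgev N w⁻¹ hwU
  rw [norm_inv] at h
  have hsum : ∑ n ∈ Finset.range N, a n * (w⁻¹) ^ n = a 0 + ∑ n ∈ Finset.Ico 1 N, a n * (w⁻¹) ^ n := by
    rw [Finset.range_eq_Ico, Finset.sum_eq_sum_Ico_succ_bot hN]
    simp
  have hs2 : ∑ n ∈ Finset.Ico 1 N, a n * (1 / w ^ (n + 1)) = (∑ n ∈ Finset.Ico 1 N, a n * (w⁻¹) ^ n) / w := by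
    rw [Finset.sum_div]
    refine Finset.sum_congr rfl fun n _ => ?_
    rw [inv_pow, pow_succ]
    field_simp
  have halg : (f w⁻¹ - a 0) / w - ∑ n ∈ Finset.Ico 1 N, a n * (1 / w ^ (n + 1)) =
      (f w⁻¹ - ∑ n ∈ Finset.range N, a n * (w⁻¹) ^ n) / w := by
    rw [hsum, hs2]
    field_simp
    ring
  simp only
  rw [halg, norm_div, div_le_div_iff₀ hwpos (by positivity)]
  calc ‖f w⁻¹ - ∑ n ∈ Finset.range N, a n * w⁻¹ ^ n‖ * ‖w‖ ^ (N + 1)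
      ≤ C * K ^ N * N ! * ‖w‖⁻¹ ^ N * ‖w‖ ^ (N + 1) := mul_le_mul_of_nonneg_right h (by positivity)
    _ = C * K ^ N * N ! * ‖w‖ := by rw [inv_pow, pow_succ]; field_simp

/-- The small positive reals lie in the Borel DISC `{Re z⁻¹ > ρ}` (`0 < x < 1∕ρ`). [folklore] -/
theorem ofReal_mem_borelDisc {ρ x : ℝ} (hρ : 0 < ρ) (hx : 0 < x) (hxr : x < 1 / ρ) :
    ((x : ℂ)) ∈ {z : ℂ | ρ < (z⁻¹).re} := by
  show ρ < (((x : ℂ))⁻¹).re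
  rw [← Complex.ofReal_inv, Complex.ofReal_re]
  rwa [lt_inv_comm₀ hρ hx, ← one_div]

/-- A point of the half-plane `Re w > ρ ≥ 0` is non-zero and its inverse lies in the Borel disc `{Re z⁻¹ > ρ}`. [folklore] -/
theorem inv_mem_borelDisc {ρ : ℝ} (hρ : 0 ≤ ρ) {w : ℂ} (hw : ρ < w.re) :
    w ≠ 0 ∧ w⁻¹ ∈ {z : ℂ | ρ < (z⁻¹).re} := by
  refine ⟨fun h => ?_, ?_⟩
  · rw [h, Complex.zero_re] at hw; linarith
  · show ρ < (w⁻¹⁻¹).re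
    rwa [inv_inv]

/-! ## §2 The line forms -/

/-- **Bromwich line = Fourier slice, without the factor `i`**: `∫_ℝ e^{t(c+is)}G(c+is)ds = e^{ct}·𝓕[G(c − i·)](t∕2π)` (34c
`line_eq_fourier`). [folklore] -/
theorem line_eq_bline (G : ℂ → ℂ) (c t : ℝ) :
    ∫ s : ℝ, cexp ((t : ℂ) * ((c : ℂ) + (s : ℂ) * I)) * G ((c : ℂ) + (s : ℂ) * I) =
      (Real.exp (c * t) : ℂ) * 𝓕 (fun x : ℝ => G ((c : ℂ) - (x : ℂ) * I)) (t / (2 * π)) := by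
  have h := line_eq_fourier G c t
  rw [integral_mul_const] at h
  have hI : (I : ℂ) ≠ 0 := Complex.I_ne_zero
  have h2 : (∫ s : ℝ, cexp ((t : ℂ) * ((c : ℂ) + (s : ℂ) * I)) * G ((c : ℂ) + (s : ℂ) * I)) * I =
      ((Real.exp (c * t) : ℂ) * 𝓕 (fun x : ℝ => G ((c : ℂ) - (x : ℂ) * I)) (t / (2 * π))) * I := by
    rw [h]; ring
  exact mul_right_cancel₀ hI h2

/-- **Size of a line integral**: `‖H(c+is)‖ ≤ D∕(c²+s²)` for all `s` (`c > 0`) ⟹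
`‖∫_ℝ e^{t(c+is)}H(c+is)ds‖ ≤ e^{ct}·D·π∕c`. [folklore] -/
theorem norm_line_le {H : ℂ → ℂ} {c D : ℝ} (hc : 0 < c)
    (hHb : ∀ s : ℝ, ‖H ((c : ℂ) + (s : ℂ) * I)‖ ≤ D / (c ^ 2 + s ^ 2)) (t : ℝ) :
    ‖∫ s : ℝ, cexp ((t : ℂ) * ((c : ℂ) + (s : ℂ) * I)) * H ((c : ℂ) + (s : ℂ) * I)‖ ≤ Real.exp (c * t) * D * π / c := by
  have hbound : ∀ s : ℝ, ‖cexp ((t : ℂ) * ((c : ℂ) + (s : ℂ) * I)) * H ((c : ℂ) + (s : ℂ) * I)‖ ≤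
      Real.exp (c * t) * D * (c ^ 2 + s ^ 2)⁻¹ := by
    intro s
    rw [norm_mul, Complex.norm_exp]
    have hre : ((t : ℂ) * ((c : ℂ) + (s : ℂ) * I)).re = c * t := by simp [Complex.mul_re]; ring
    rw [hre]
    calc Real.exp (c * t) * ‖H ((c : ℂ) + (s : ℂ) * I)‖ ≤ Real.exp (c * t) * (D / (c ^ 2 + s ^ 2)) :=
          mul_le_mul_of_nonneg_left (hHb s) (Real.exp_pos _).le
      _ = Real.exp (c * t) * D * (c ^ 2 + s ^ 2)⁻¹ := by rw [div_eq_mul_inv]; ring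
  calc ‖∫ s : ℝ, cexp ((t : ℂ) * ((c : ℂ) + (s : ℂ) * I)) * H ((c : ℂ) + (s : ℂ) * I)‖
      ≤ ∫ s : ℝ, Real.exp (c * t) * D * (c ^ 2 + s ^ 2)⁻¹ :=
        norm_integral_le_of_norm_le ((integrable_inv_sq_add_sq hc).const_mul _) (Eventually.of_forall hbound)
    _ = Real.exp (c * t) * D * π / c := by rw [integral_const_mul, integral_inv_sq_add_sq hc]; ring

/-- **The line integral of the monomials**: `∫_ℝ e^{t(c+is)}(c+is)^{−(n+1)}ds = 2π·tⁿ∕n!` for `t ≥ 0`, `n ≥ 1`, `c > 0` (34d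
`bline_monomial`). [folklore] -/
theorem line_monomial {c : ℝ} (hc : 0 < c) {n : ℕ} (hn : 1 ≤ n) {t : ℝ} (ht : 0 ≤ t) :
    ∫ s : ℝ, cexp ((t : ℂ) * ((c : ℂ) + (s : ℂ) * I)) * (1 / ((c : ℂ) + (s : ℂ) * I) ^ (n + 1)) =
      2 * π * ((t : ℂ) ^ n / (n ! : ℂ)) := by
  have h := bline_monomial (c₀ := c / 2) (by positivity) hn (c := c) (by linarith) ht
  rw [line_eq_bline (fun w : ℂ => 1 / w ^ (n + 1)) c t]
  have hπ : (2 * π : ℂ) ≠ 0 := by exact_mod_cast (by positivity : (2 * π : ℝ) ≠ 0)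
  set X : ℂ := 𝓕 (fun x : ℝ => (fun w : ℂ => 1 / w ^ (n + 1)) ((c : ℂ) - (x : ℂ) * I)) (t / (2 * π)) with hX
  have e : (Real.exp (c * t) : ℂ) * X = 2 * π * ((1 / (2 * π) : ℂ) * (Real.exp (c * t) : ℂ) * X) := by
    rw [← mul_assoc, ← mul_assoc, mul_one_div_cancel hπ, one_mul]
  rw [e, h]

/-! ## §3 The remainder `R_N = G − Σ_{1≤n<N} a_n∕w^{n+1}` on the line `Re w = c` -/

/-- **The remainder on the line**: `‖R_N(w)‖ ≤ CK^N N!∕‖w‖^{N+1}` on `Re w > c₀` and `c > c₀ > 0` ⟹ for `j ≤ N − 1` and all real `s`: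
`‖(c+is)^j R_N(c+is)‖ ≤ (CK^N N!∕c^{N−1−j})∕(c²+s²)`. [folklore] -/
theorem remainder_line_bound {R : ℂ → ℂ} {c₀ c D : ℝ} {N j : ℕ} (hc₀ : 0 < c₀) (hc : c₀ < c) (hD : 0 ≤ D) (hj : j + 1 ≤ N)
    (hRb : ∀ w : ℂ, c₀ < w.re → ‖R w‖ ≤ D / ‖w‖ ^ (N + 1)) (s : ℝ) :
    ‖((c : ℂ) + (s : ℂ) * I) ^ j * R ((c : ℂ) + (s : ℂ) * I)‖ ≤ (D / c ^ (N - 1 - j)) / (c ^ 2 + s ^ 2) := by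
  set w : ℂ := (c : ℂ) + (s : ℂ) * I with hw
  have hcpos : 0 < c := hc₀.trans hc
  have hwre : c₀ < w.re := by simp [hw]; exact hc
  have hwn : c ≤ ‖w‖ := by
    have := Complex.re_le_norm w; simp [hw] at this ⊢; exact this
  have hwpos : 0 < ‖w‖ := hcpos.trans_le hwn
  have hsq : ‖w‖ ^ 2 = c ^ 2 + s ^ 2 := by rw [hw]; exact norm_sq_line c s
  obtain ⟨m, hm⟩ : ∃ m, N = j + 1 + m := ⟨N - (j + 1), by omega⟩
  have hNj : N - 1 - j = m := by omega
  rw [norm_mul, norm_pow, hNj, ← hsq]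
  calc ‖w‖ ^ j * ‖R w‖ ≤ ‖w‖ ^ j * (D / ‖w‖ ^ (N + 1)) := mul_le_mul_of_nonneg_left (hRb w hwre) (by positivity)
    _ = D / (‖w‖ ^ m * ‖w‖ ^ 2) := by
        rw [hm, show j + 1 + m + 1 = j + (m + 2) by ring, pow_add, pow_add]
        field_simp
    _ ≤ D / (c ^ m * ‖w‖ ^ 2) := by
        apply div_le_div_of_nonneg_left hD (by positivity)
        exact mul_le_mul_of_nonneg_right (pow_le_pow_left₀ hcpos.le hwn m) (by positivity)
    _ = D / c ^ m / ‖w‖ ^ 2 := by rw [div_div]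

/-- Continuity along the line of `R_N = G − Σ_{1≤n<N} a_n∕w^{n+1}` (`G` holomorphic on `Re w > c₀`, `c > c₀ > 0`). [folklore] -/
theorem continuous_remainder_line {G : ℂ → ℂ} {a : ℕ → ℂ} {c₀ c : ℝ} {N : ℕ} (hc₀ : 0 < c₀) (hc : c₀ < c)
    (hG : DifferentiableOn ℂ G {w : ℂ | c₀ < w.re}) :
    Continuous fun s : ℝ =>
      (fun w : ℂ => G w - ∑ n ∈ Finset.Ico 1 N, a n * (1 / w ^ (n + 1))) ((c : ℂ) + (s : ℂ) * I) := by
  have hline : Continuous fun s : ℝ => (c : ℂ) + (s : ℂ) * I := by fun_prop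
  have hmem : ∀ s : ℝ, (c : ℂ) + (s : ℂ) * I ∈ {w : ℂ | c₀ < w.re} := fun s => by simp; exact hc
  have hne : ∀ s : ℝ, (c : ℂ) + (s : ℂ) * I ≠ 0 := fun s h => by
    have := hmem s; rw [h] at this; simp at this; linarith
  have hGc : Continuous fun s : ℝ => G ((c : ℂ) + (s : ℂ) * I) :=
    hG.continuousOn.comp_continuous hline hmem
  refine hGc.sub (continuous_finsetSum _ fun n _ => continuous_const.mul ?_)
  exact continuous_const.div (hline.pow _) fun s => pow_ne_zero _ (hne s)

/-! ## §4 The decomposition of the Borel transform on the line -/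

/-- **LETTERS + REMAINDER.**  `G` holomorphic on `Re w > c₀ > 0` with `‖G w − Σ_{1≤n<N} a_n∕w^{n+1}‖ ≤ CK^N N!∕‖w‖^{N+1}` for this
`N ≥ 1`, `C ≥ 0`, `c > c₀`, `t ≥ 0` ⟹ `∫_ℝ e^{t(c+is)}G(c+is)ds = 2π·Σ_{1≤n<N} a_n tⁿ∕n! + ∫_ℝ e^{t(c+is)}R_N(c+is)ds`
(`R_N = G − Σ_{1≤n<N} a_n∕w^{n+1}`; linearity of the absolutely convergent line integrals and §2 `line_monomial`). [folklore] -/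
theorem line_decomposition {G : ℂ → ℂ} {a : ℕ → ℂ} {c₀ c C K : ℝ} {N : ℕ} (hc₀ : 0 < c₀) (hc : c₀ < c) (hC : 0 ≤ C)
    (hK : 0 ≤ K) (hN : 1 ≤ N) (hG : DifferentiableOn ℂ G {w : ℂ | c₀ < w.re})
    (hrem : ∀ w : ℂ, c₀ < w.re → ‖G w - ∑ n ∈ Finset.Ico 1 N, a n * (1 / w ^ (n + 1))‖ ≤ C * K ^ N * N ! / ‖w‖ ^ (N + 1))
    {t : ℝ} (ht : 0 ≤ t) :
    ∫ s : ℝ, cexp ((t : ℂ) * ((c : ℂ) + (s : ℂ) * I)) * G ((c : ℂ) + (s : ℂ) * I) =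
      2 * π * ∑ n ∈ Finset.Ico 1 N, a n * ((t : ℂ) ^ n / (n ! : ℂ)) +
      ∫ s : ℝ, cexp ((t : ℂ) * ((c : ℂ) + (s : ℂ) * I)) *
        (fun w : ℂ => G w - ∑ n ∈ Finset.Ico 1 N, a n * (1 / w ^ (n + 1))) ((c : ℂ) + (s : ℂ) * I) := by
  have hcpos : 0 < c := hc₀.trans hc
  set R : ℂ → ℂ := fun w : ℂ => G w - ∑ n ∈ Finset.Ico 1 N, a n * (1 / w ^ (n + 1)) with hR
  -- integrability of the pieces
  have hRc : Continuous fun s : ℝ => R ((c : ℂ) + (s : ℂ) * I) := continuous_remainder_line (a := a) (N := N) hc₀ hc hG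
  have hRb : ∀ s : ℝ, ‖R ((c : ℂ) + (s : ℂ) * I)‖ ≤ (C * K ^ N * N ! / c ^ (N - 1 - 0)) / (c ^ 2 + s ^ 2) := by
    intro s
    have h := remainder_line_bound (R := R) (j := 0) hc₀ hc (by positivity) (by omega) (fun w hw => hrem w hw) s
    simpa using h
  have hRi := integrable_line_of_bound hcpos hRc hRb t
  have hline : Continuous fun s : ℝ => (c : ℂ) + (s : ℂ) * I := by fun_prop
  have hne : ∀ s : ℝ, (c : ℂ) + (s : ℂ) * I ≠ 0 := fun s h => by
    have := congrArg Complex.re h; simp at this; linarith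
  have hMc : ∀ n : ℕ, Continuous fun s : ℝ => (fun w : ℂ => 1 / w ^ (n + 1)) ((c : ℂ) + (s : ℂ) * I) := fun n =>
    continuous_const.div (hline.pow _) fun s => pow_ne_zero _ (hne s)
  have hMb : ∀ n : ℕ, 1 ≤ n → ∀ s : ℝ, ‖(fun w : ℂ => 1 / w ^ (n + 1)) ((c : ℂ) + (s : ℂ) * I)‖ ≤
      (1 / (c / 2) ^ (n - 1)) / (c ^ 2 + s ^ 2) := by
    intro n hn s
    have h := norm_monomial_le (c₀ := c / 2) (by positivity) hn ((c : ℂ) + (s : ℂ) * I) (by simp; linarith)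
    rwa [norm_sq_line] at h
  have hMi : ∀ n ∈ Finset.Ico 1 N, Integrable fun s : ℝ =>
      cexp ((t : ℂ) * ((c : ℂ) + (s : ℂ) * I)) * (a n * (1 / ((c : ℂ) + (s : ℂ) * I) ^ (n + 1))) := by
    intro n hn
    have hn1 : 1 ≤ n := (Finset.mem_Ico.mp hn).1
    have h := (integrable_line_of_bound hcpos (hMc n) (hMb n hn1) t).const_mul (a n)
    exact h.congr (Eventually.of_forall fun s => by ring)
  -- split the integrand
  have hsplit : ∀ s : ℝ, cexp ((t : ℂ) * ((c : ℂ) + (s : ℂ) * I)) * G ((c : ℂ) + (s : ℂ) * I) =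
      (∑ n ∈ Finset.Ico 1 N, cexp ((t : ℂ) * ((c : ℂ) + (s : ℂ) * I)) * (a n * (1 / ((c : ℂ) + (s : ℂ) * I) ^ (n + 1)))) +
      cexp ((t : ℂ) * ((c : ℂ) + (s : ℂ) * I)) * R ((c : ℂ) + (s : ℂ) * I) := by
    intro s
    simp only [hR, ← Finset.mul_sum]
    ring
  rw [integral_congr_ae (Eventually.of_forall hsplit), integral_add (integrable_finsetSum _ hMi) hRi,
    integral_finsetSum _ hMi, Finset.mul_sum]
  congr 1
  refine Finset.sum_congr rfl fun n hn => ?_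
  have hn1 : 1 ≤ n := (Finset.mem_Ico.mp hn).1
  have e : (fun s : ℝ => cexp ((t : ℂ) * ((c : ℂ) + (s : ℂ) * I)) * (a n * (1 / ((c : ℂ) + (s : ℂ) * I) ^ (n + 1)))) =
      fun s : ℝ => a n * (cexp ((t : ℂ) * ((c : ℂ) + (s : ℂ) * I)) * (1 / ((c : ℂ) + (s : ℂ) * I) ^ (n + 1))) := by
    funext s; ring
  rw [e, integral_const_mul, line_monomial hcpos hn1 ht]
  ring

end

end Summit.QuantumFields.BalabanUV.Beta.EriceFlowEnclosureBorelTransformPieces
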